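import Summits.Ventures.QEC.Census.CertCheckBZAutSound
import Summits.Ventures.QEC.Census.BB.BB144.OrbitBZCover
import Literature.InformationTheory.QuantumCodes.HypergraphProductSectorDistances
import HarnessLib

/-!
# The `bz_aut` lower bound of a bivariate-bicycle code, GENERIC in `(ℓ, m)`, the code and the certificate
# (qec row 12 — automorphism-orbit reduction, cashed in: the closer every BB `bz_aut` certificate instantiates)

qec-type-10's `Theorems/BB144DistanceCertificateLowerZ(Kernel).lean` assembles, for `[[144,12,12]]` and ONE certificate,
the Brouwer–Zimmermann-with-automorphisms lower bound from: the checker's structural verdicts (`bzCoreOK`, `bzLenOK`,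
`foundOK`), the per-block verdicts (`bzBlockOK`, from the enumeration files), the 72 translations of `ℤ₁₂ × ℤ₆` as
row-map automorphisms of the certificate's matrices, type-12's label action / label cover (`coverAutTabOK`), through
type-10's `bzAut_lower_sound`.  Nothing in that assembly is specific to `144`: this file states it ONCE for every
`ℓ, m`, every pair of check-word lists `HX`, `HZ` on `n = ℓm + ℓm` flat qubits that the translations
`BB.translateFlat t` (`t ∈ ℤ_ℓ × ℤ_m`) preserve up to row maps, every `BZSide`, and ANY list `taus` of translations for
the cover (the tabulated check validates its own entries):

* `bzAut_translate_lower` — certificate level: `… → ∀ w, HX w = 0 → w ∉ rowspace HZ → wmax < |w|`;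
* `BB.bzAut_translate_lower_of_submatrix` — the same with the automorphism and commutation hypotheses DISCHARGED from a
  typed code `C : BB.Code ℓ m` whose flat matrices are the certificate's up to a row bijection
  (`rowMatrix n HX = C.HXFlat.submatrix eX id`; for emitted certificates `eX = Equiv.refl _` and the hypothesis is the
  index identity `rowMatrix n cert.HX = C.HXFlat` of the witness files), concluding on the TYPED matrices:
  `∀ w, C.HXFlat w = 0 → w ∉ rowspace C.HZFlat → wmax < |w|` — the input of type-05's `zLowerBound_of_flat` /
  type-12's `BB.d_eq_of_forall_lt_flat(_of_isBBPoly)` closers.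

So a KERNEL-std lower-bound file for ANY bivariate-bicycle `bz_aut` certificate (BB144 4-block α′/β, BB108, census rows)
is: its `decide`d verdicts + ONE application of `BB.bzAut_translate_lower_of_submatrix`.  USE (elaborated as a scratch
against the 15-block `BB144` data, re-deriving type-10's `twelve_le_flat_of_blocks` p477850):

    have h := BB.bzAut_translate_lower_of_submatrix BB.bb144 (HX := cert.HX) (HZ := cert.HZ)
      (Equiv.refl _) (Equiv.refl _) (by exact HX_eq_flat) (by exact HZ_eq_flat)   -- index identities, `exact` (defeq)
      (s := bzAutData.sideZ) foundZ_ok core_ok len_ok hblocks coverAutTabOK_bb144 w hw hw'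
    -- h : cert.dZ - 1 < hammingNorm w   (for `hblocks : ∀ b < _, cert.bzZBlock bzAutData b = true`)

(the literal `cert.n` of the verdicts unifies with `ℓ * m + ℓ * m` by evaluation; use `exact`, not `rw`, for the index
identities).  The certificate-level form takes instead the two automorphism families, e.g.
`(fun t => BB.checkTranslateFlat t)` with `fun t => by have h := BB.HXFlat_submatrix_translateFlat C t; rw [← HX_eq_flat] at h; exact h`.
HONEST FRAMING: no certificate is read here and no distance value is asserted; tier KERNEL, axioms standard.  Sources: Brouwer–Zimmermann with
automorphisms [Grassl 2006 §2.2], translations of both tori are automorphisms [Bravyi et al. 2024 SI §9.2],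
label action [ibid. §9.2–9.3]; the Lean ingredients are type-10 `CertCheckBZAutSound` (p473245), type-07 `BZAutBBFlat`
(p470223), type-12 `AutomorphismLabelAction` (p467242) / `OrbitBZCover` (p472938/p473901).
-/

namespace Summit.Ventures.QEC.Census

open Matrix Literature.InformationTheory.QuantumCodes Literature.InformationTheory.QuantumCodes.BB

section Generic

variable {ℓ m : ℕ} [NeZero ℓ] [NeZero m]

/-- **The `bz_aut` lower bound with translation automorphisms, certificate level, generic.**  Check words `HX`
(syndromes) and `HZ` (stabilizers) on `n = ℓm + ℓm` flat qubits, commuting; rank certificates, paired logical bases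
`L`/`Ld`, a `BZSide` `s` whose core / length / block verdicts hold at threshold `wmax` with allow-list `found`; row maps
`ρX t`, `ρZ t` making every flat translation `BB.translateFlat t` an automorphism of both matrices; and the TABULATED
label cover `coverAutTabOK ℓ m Ld L taus s.blocks` over any list of translations.  Then every flat vector with zero
syndrome outside the stabilizer row space has weight `> wmax`. -/
theorem bzAut_translate_lower
    {HX HZ : List ℕ} {rcY rcS : RankCert} {L Ld : List ℕ} {s : BZSide} {wmax : ℕ} {found : List (ℕ × List ℕ)}
    (hcomm : rowMatrix (ℓ * m + ℓ * m) HX * (rowMatrix (ℓ * m + ℓ * m) HZ)ᵀ = 0)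
    (hfound : foundOK HZ found = true)
    (hcore : bzCoreOK (ℓ * m + ℓ * m) HX HZ rcY rcS L Ld s.evenWitness = true)
    (hlen : bzLenOK HZ rcS L s = true)
    (hb : ∀ b : ℕ, b < s.blocks.length → bzBlockOK (ℓ * m + ℓ * m) HZ rcS L wmax (found.map Prod.fst) s b = true)
    (ρX : Mono ℓ m → Fin HX.length → Fin HX.length) (ρZ : Mono ℓ m → Fin HZ.length → Fin HZ.length)
    (hXaut : ∀ t : Mono ℓ m,
      (rowMatrix (ℓ * m + ℓ * m) HX).submatrix (ρX t) (BB.translateFlat t) = rowMatrix (ℓ * m + ℓ * m) HX)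
    (hZaut : ∀ t : Mono ℓ m,
      (rowMatrix (ℓ * m + ℓ * m) HZ).submatrix (ρZ t) (BB.translateFlat t) = rowMatrix (ℓ * m + ℓ * m) HZ)
    {taus : List (ℕ × ℕ)} (hcov : coverAutTabOK ℓ m Ld L taus s.blocks = true)
    (w : Fin (ℓ * m + ℓ * m) → ZMod 2) (hw : rowMatrix (ℓ * m + ℓ * m) HX *ᵥ w = 0)
    (hw' : w ∉ rowSpace (rowMatrix (ℓ * m + ℓ * m) HZ)) : wmax < hammingNorm w := by
  -- structural facts unpacked once
  have hcore' := hcore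
  simp only [bzCoreOK, Bool.and_eq_true, beq_iff_eq] at hcore'
  obtain ⟨⟨⟨⟨hY, hS⟩, hL⟩, hdim⟩, -⟩ := hcore'
  -- the certificate's CSS code and logical matrices on flat indices
  let C : CSSCode (Fin HX.length) (Fin HZ.length) (Fin (ℓ * m + ℓ * m)) :=
    CSSCode.ofMatrices (rowMatrix (ℓ * m + ℓ * m) HX) (rowMatrix (ℓ * m + ℓ * m) HZ) hcomm
  let LXmat : Matrix (Fin L.length) (Fin (ℓ * m + ℓ * m)) (ZMod 2) := ldMat (ℓ * m + ℓ * m) L Ld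
  let LZmat : Matrix (Fin L.length) (Fin (ℓ * m + ℓ * m)) (ZMod 2) := fun i => logVec (ℓ * m + ℓ * m) L i
  -- the pairing `LX · LZᵀ = 1`
  have hpair : LXmat * LZmatᵀ = 1 := by
    ext j i
    rw [Matrix.mul_apply', Matrix.one_apply]
    change ldMat (ℓ * m + ℓ * m) L Ld j ⬝ᵥ logVec (ℓ * m + ℓ * m) L i = _
    rw [ldMat, dual_dotProduct_logVec hL i j]
    by_cases h : i = j
    · subst h; simp
    · rw [if_neg h, if_neg (fun e => h e.symm)]
  -- the label-action ingredients
  have hLX : ∀ a, C.HZ *ᵥ LXmat a = 0 := fun a => mulVec_dual_eq_zero hL a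
  have hexp : ∀ z, C.HX *ᵥ z = 0 → z - (LXmat *ᵥ z) ᵥ* LZmat ∈ C.rowSpZ := fun z hz =>
    C.sub_label_vecMul_mem_rowSpZ hLX hpair (exists_coeffs_of_ker hcomm hY hS hL hdim hz)
  refine bzAut_lower_sound (s := s) hcomm hfound hcore hlen hb
    (α := {t : Mono ℓ m // (((t.1 : Fin ℓ) : ℕ), ((t.2 : Fin m) : ℕ)) ∈ taus})
    (fun a z => z ∘ (BB.translateFlat a.1).symm)
    (fun a => LXmat * (LZmat.submatrix id (BB.translateFlat a.1).symm)ᵀ)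
    (fun a z hz hz' => ?_) (fun lam hlam => ?_) w hw hw'
  · -- transport by the translation `a.1`: row-map automorphism facts on the certificate's matrices
    have hXsub : C.HX.submatrix (ρX a.1) (BB.translateFlat a.1) = C.HX := hXaut a.1
    have hZsub : C.HZ.submatrix (ρZ a.1) (BB.translateFlat a.1) = C.HZ := hZaut a.1
    obtain ⟨h1, h2⟩ := C.zLogical_comp_equiv_symm_of_rowMap hXsub hZsub ⟨hz, hz'⟩
    exact ⟨h1, h2, hammingNorm_comp_equiv z (BB.translateFlat a.1), C.label_comp_equiv_symm hLX hexp hZsub hz⟩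
  · -- cover by translates (type-12 tabulated C5, kernel-decidable)
    rcases coverAutTabOK_sound (ℓ := ℓ) (m := m) hcov
        (P := fun μ => ∃ b : Fin s.blocks.length, μ ∈ Submodule.span (ZMod 2)
          (Set.range fun l : Fin (s.blocks[b]).W.length => ofBits L.length (s.blocks[b]).W[l]))
        (fun v hv => testBit_coverMask_imp_exists_span _ _ hv)
        (Ld' := LXmat) (L' := LZmat) (fun i => rfl)
        (fun j => by
          change ofBits (ℓ * m + ℓ * m) L[j] = ofBits (ℓ * m + ℓ * m) (L.getD j 0)
          rw [List.getD_eq_getElem?_getD, List.getElem?_eq_getElem j.2, Option.getD_some]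
          rfl)
        lam hlam with hP | ⟨t, ht, hPt⟩
    · exact Or.inl hP
    · obtain ⟨b, hb⟩ := hPt
      exact Or.inr ⟨⟨t, ht⟩, b, hb⟩

/-- Row reindexing along a bijection composed with a row-map automorphism is a row-map automorphism of the reindexed
matrix. -/
private theorem submatrix_aut_of_submatrix_equiv {R R' Q : Type*} (A : Matrix R Q (ZMod 2)) (e : R' ≃ R)
    {ρ : R → R} {σ : Q → Q} (h : A.submatrix ρ σ = A) :
    (A.submatrix e id).submatrix (e.symm ∘ ρ ∘ e) σ = A.submatrix e id := by
  ext i j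
  have := congrFun (congrFun h (e i)) j
  simp only [submatrix_apply, Function.comp_apply, Equiv.apply_symm_apply, id_eq] at this ⊢
  exact this

/-- **The `bz_aut` lower bound for a TYPED bivariate-bicycle code `C : BB.Code ℓ m`, generic.**  If the
certificate's check words ARE the code's flat matrices up to a row bijection (`rowMatrix n HX = C.HXFlat.submatrix eX id`,
`rowMatrix n HZ = C.HZFlat.submatrix eZ id`; for emitted certificates `eX = eZ = Equiv.refl _`), then the `72`-style
translation automorphisms and the commutation come from the code (`BB.HXFlat_submatrix_translateFlat`,
`BB.Code.HXFlat_mul_HZFlat_transpose`), and the checker verdicts + the tabulated cover give: every flat vector `w` with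
`C.HXFlat w = 0` outside `rowspace C.HZFlat` has weight `> wmax`. -/
theorem BB.bzAut_translate_lower_of_submatrix (C : BB.Code ℓ m)
    {HX HZ : List ℕ} (eX : Fin HX.length ≃ Fin (ℓ * m)) (eZ : Fin HZ.length ≃ Fin (ℓ * m))
    (hX : rowMatrix (ℓ * m + ℓ * m) HX = C.HXFlat.submatrix eX id)
    (hZ : rowMatrix (ℓ * m + ℓ * m) HZ = C.HZFlat.submatrix eZ id)
    {rcY rcS : RankCert} {L Ld : List ℕ} {s : BZSide} {wmax : ℕ} {found : List (ℕ × List ℕ)}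
    (hfound : foundOK HZ found = true)
    (hcore : bzCoreOK (ℓ * m + ℓ * m) HX HZ rcY rcS L Ld s.evenWitness = true)
    (hlen : bzLenOK HZ rcS L s = true)
    (hb : ∀ b : ℕ, b < s.blocks.length → bzBlockOK (ℓ * m + ℓ * m) HZ rcS L wmax (found.map Prod.fst) s b = true)
    {taus : List (ℕ × ℕ)} (hcov : coverAutTabOK ℓ m Ld L taus s.blocks = true)
    (w : Fin (ℓ * m + ℓ * m) → ZMod 2) (hw : C.HXFlat *ᵥ w = 0) (hw' : w ∉ rowSpace C.HZFlat) :
    wmax < hammingNorm w := by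
  have hcomm : rowMatrix (ℓ * m + ℓ * m) HX * (rowMatrix (ℓ * m + ℓ * m) HZ)ᵀ = 0 := by
    rw [hX, hZ, transpose_submatrix, ← Matrix.submatrix_mul _ _ _ _ _ Function.bijective_id,
      C.HXFlat_mul_HZFlat_transpose]
    simp
  have hXaut : ∀ t : Mono ℓ m, (rowMatrix (ℓ * m + ℓ * m) HX).submatrix
      (eX.symm ∘ BB.checkTranslateFlat t ∘ eX) (BB.translateFlat t) = rowMatrix (ℓ * m + ℓ * m) HX := by
    intro t
    rw [hX]
    exact submatrix_aut_of_submatrix_equiv C.HXFlat eX (BB.HXFlat_submatrix_translateFlat C t)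
  have hZaut : ∀ t : Mono ℓ m, (rowMatrix (ℓ * m + ℓ * m) HZ).submatrix
      (eZ.symm ∘ BB.checkTranslateFlat t ∘ eZ) (BB.translateFlat t) = rowMatrix (ℓ * m + ℓ * m) HZ := by
    intro t
    rw [hZ]
    exact submatrix_aut_of_submatrix_equiv C.HZFlat eZ (BB.HZFlat_submatrix_translateFlat C t)
  have hw₁ : rowMatrix (ℓ * m + ℓ * m) HX *ᵥ w = 0 := by
    rw [hX]
    funext i
    have := congrFun hw (eX i)
    simpa [mulVec, submatrix] using this
  have hw₁' : w ∉ rowSpace (rowMatrix (ℓ * m + ℓ * m) HZ) := by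
    rw [hZ, rowSpace_submatrix_equiv_rows]
    exact hw'
  exact bzAut_translate_lower hcomm hfound hcore hlen hb _ _ hXaut hZaut hcov w hw₁ hw₁'

end Generic

/-! ## Engine-agnostic form (appended): the two BB-specific HYPOTHESES of any `bz_aut` side-soundness theorem

type-10's `bzAut_lower_sound` (BZ enumeration verdicts), qec-search-9's `bzAut_lower_sound_mitm` (meet-in-the-middle
verdicts, lane β) and any later engine (lane δ) share ONE interface: an index type `α` of automorphisms, the transport
`φ`, the label action `ρ`, and the two hypotheses `hφ` (transport preserves non-trivial `Z`-logicals, weight, and acts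
on labels by `ρ`) and `hcover` (every non-zero label, or some `ρ a`-image, lies in a block's label span).  For a
bivariate-bicycle certificate with `α := {t : ℤ_ℓ × ℤ_m // (t₁,t₂) ∈ taus}`, `φ a z := z ∘ (translateFlat a)⁻¹`,
`ρ a := LX · (LZ ∘ (translateFlat a)⁻¹)ᵀ` these two hypotheses are discharged HERE once and for all
(`bzAut_translate_hφ`, `bzAut_translate_hcover`; `LX = ldMat n L Ld`, `LZ = (logVec n L ·)` as in type-10's files), so the KERNEL-std closer over ANY engine is
`engine_sound hcomm hfound hcore hlen hverdicts _ _ (bzAut_translate_hφ hcomm hcore ρX ρZ hXaut hZaut) (bzAut_translate_hcover hcov) w hw hw'`;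
and `BB.rowMatrix_aut_of_eq_submatrix` supplies `hXaut`/`hZaut` from a typed code's index identity. -/

section EngineAgnostic

variable {ℓ m : ℕ} [NeZero ℓ] [NeZero m]

/-- **`hφ` for translations, any engine.**  With commuting check words on `n = ℓm+ℓm` qubits, the core structural verdict
(rank certificates, pairing `LX·LZᵀ = 1`, dimension count) and row maps making each flat translation an automorphism of
`HX` and `HZ`: transport by `(translateFlat t)⁻¹` maps a non-trivial `Z`-logical to a non-trivial `Z`-logical of the
same weight whose label is `ρ_t ·` the label, `ρ_t = LX · (LZ ∘ (translateFlat t)⁻¹)ᵀ` — the `hφ` hypothesis of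
`bzAut_lower_sound` / `bzAut_lower_sound_mitm` for `α := {t // (t₁,t₂) ∈ taus}` (any `taus`). -/
theorem bzAut_translate_hφ
    {HX HZ : List ℕ} {rcY rcS : RankCert} {L Ld : List ℕ} {ew : Option (List ℕ)}
    (hcomm : rowMatrix (ℓ * m + ℓ * m) HX * (rowMatrix (ℓ * m + ℓ * m) HZ)ᵀ = 0)
    (hcore : bzCoreOK (ℓ * m + ℓ * m) HX HZ rcY rcS L Ld ew = true)
    (ρX : Mono ℓ m → Fin HX.length → Fin HX.length) (ρZ : Mono ℓ m → Fin HZ.length → Fin HZ.length)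
    (hXaut : ∀ t : Mono ℓ m,
      (rowMatrix (ℓ * m + ℓ * m) HX).submatrix (ρX t) (BB.translateFlat t) = rowMatrix (ℓ * m + ℓ * m) HX)
    (hZaut : ∀ t : Mono ℓ m,
      (rowMatrix (ℓ * m + ℓ * m) HZ).submatrix (ρZ t) (BB.translateFlat t) = rowMatrix (ℓ * m + ℓ * m) HZ)
    (taus : List (ℕ × ℕ)) :
    ∀ (a : {t : Mono ℓ m // (((t.1 : Fin ℓ) : ℕ), ((t.2 : Fin m) : ℕ)) ∈ taus}) (z : Fin (ℓ * m + ℓ * m) → ZMod 2),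
      rowMatrix (ℓ * m + ℓ * m) HX *ᵥ z = 0 → z ∉ rowSpace (rowMatrix (ℓ * m + ℓ * m) HZ) →
      rowMatrix (ℓ * m + ℓ * m) HX *ᵥ (z ∘ (BB.translateFlat a.1).symm) = 0 ∧
        z ∘ (BB.translateFlat a.1).symm ∉ rowSpace (rowMatrix (ℓ * m + ℓ * m) HZ) ∧
        hammingNorm (z ∘ (BB.translateFlat a.1).symm) = hammingNorm z ∧
        ldMat (ℓ * m + ℓ * m) L Ld *ᵥ (z ∘ (BB.translateFlat a.1).symm) =
          (ldMat (ℓ * m + ℓ * m) L Ld * (Matrix.submatrix (fun i => logVec (ℓ * m + ℓ * m) L i : Matrix (Fin L.length) (Fin (ℓ * m + ℓ * m)) (ZMod 2)) id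
            (BB.translateFlat a.1).symm)ᵀ) *ᵥ
            (ldMat (ℓ * m + ℓ * m) L Ld *ᵥ z) := by
  have hcore' := hcore
  simp only [bzCoreOK, Bool.and_eq_true, beq_iff_eq] at hcore'
  obtain ⟨⟨⟨⟨hY, hS⟩, hL⟩, hdim⟩, -⟩ := hcore'
  let C : CSSCode (Fin HX.length) (Fin HZ.length) (Fin (ℓ * m + ℓ * m)) :=
    CSSCode.ofMatrices (rowMatrix (ℓ * m + ℓ * m) HX) (rowMatrix (ℓ * m + ℓ * m) HZ) hcomm
  have hpair : ldMat (ℓ * m + ℓ * m) L Ld * (fun i => logVec (ℓ * m + ℓ * m) L i : Matrix (Fin L.length) (Fin (ℓ * m + ℓ * m)) (ZMod 2))ᵀ = 1 := by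
    ext j i
    rw [Matrix.mul_apply', Matrix.one_apply]
    change ldMat (ℓ * m + ℓ * m) L Ld j ⬝ᵥ logVec (ℓ * m + ℓ * m) L i = _
    rw [ldMat, dual_dotProduct_logVec hL i j]
    by_cases h : i = j
    · subst h; simp
    · rw [if_neg h, if_neg (fun e => h e.symm)]
  have hLX : ∀ a, C.HZ *ᵥ ldMat (ℓ * m + ℓ * m) L Ld a = 0 := fun a => mulVec_dual_eq_zero hL a
  have hexp : ∀ z, C.HX *ᵥ z = 0 →
      z - (ldMat (ℓ * m + ℓ * m) L Ld *ᵥ z) ᵥ* (fun i => logVec (ℓ * m + ℓ * m) L i : Matrix (Fin L.length) (Fin (ℓ * m + ℓ * m)) (ZMod 2)) ∈ C.rowSpZ := fun z hz =>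
    C.sub_label_vecMul_mem_rowSpZ hLX hpair (exists_coeffs_of_ker hcomm hY hS hL hdim hz)
  intro a z hz hz'
  have hXsub : C.HX.submatrix (ρX a.1) (BB.translateFlat a.1) = C.HX := hXaut a.1
  have hZsub : C.HZ.submatrix (ρZ a.1) (BB.translateFlat a.1) = C.HZ := hZaut a.1
  obtain ⟨h1, h2⟩ := C.zLogical_comp_equiv_symm_of_rowMap hXsub hZsub ⟨hz, hz'⟩
  exact ⟨h1, h2, hammingNorm_comp_equiv z (BB.translateFlat a.1), C.label_comp_equiv_symm hLX hexp hZsub hz⟩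

/-- **`hcover` for translations, any engine.**  The TABULATED label cover `coverAutTabOK ℓ m Ld L taus blocks` gives the
`hcover` hypothesis of `bzAut_lower_sound` / `bzAut_lower_sound_mitm` for `α := {t // (t₁,t₂) ∈ taus}`,
`ρ_t = LX · (LZ ∘ (translateFlat t)⁻¹)ᵀ` and the blocks' label spans. -/
theorem bzAut_translate_hcover {L Ld : List ℕ} {taus : List (ℕ × ℕ)} {blocks : List BZBlock}
    (hcov : coverAutTabOK ℓ m Ld L taus blocks = true) :
    ∀ lam : Fin L.length → ZMod 2, lam ≠ 0 →
      (∃ b : Fin blocks.length, lam ∈ Submodule.span (ZMod 2)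
        (Set.range fun l : Fin (blocks[b]).W.length => ofBits L.length (blocks[b]).W[l])) ∨
      ∃ (a : {t : Mono ℓ m // (((t.1 : Fin ℓ) : ℕ), ((t.2 : Fin m) : ℕ)) ∈ taus}) (b : Fin blocks.length),
        (ldMat (ℓ * m + ℓ * m) L Ld * (Matrix.submatrix (fun i => logVec (ℓ * m + ℓ * m) L i : Matrix (Fin L.length) (Fin (ℓ * m + ℓ * m)) (ZMod 2)) id
            (BB.translateFlat a.1).symm)ᵀ) *ᵥ
            lam ∈ Submodule.span (ZMod 2)
          (Set.range fun l : Fin (blocks[b]).W.length => ofBits L.length (blocks[b]).W[l]) := by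
  intro lam hlam
  rcases coverAutTabOK_sound (ℓ := ℓ) (m := m) hcov
      (P := fun μ => ∃ b : Fin blocks.length, μ ∈ Submodule.span (ZMod 2)
        (Set.range fun l : Fin (blocks[b]).W.length => ofBits L.length (blocks[b]).W[l]))
      (fun v hv => testBit_coverMask_imp_exists_span _ _ hv)
      (Ld' := ldMat (ℓ * m + ℓ * m) L Ld) (L' := fun i => logVec (ℓ * m + ℓ * m) L i) (fun i => rfl)
      (fun j => by
        change ofBits (ℓ * m + ℓ * m) L[j] = ofBits (ℓ * m + ℓ * m) (L.getD j 0)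
        rw [List.getD_eq_getElem?_getD, List.getElem?_eq_getElem j.2, Option.getD_some]
        rfl)
      lam hlam with hP | ⟨t, ht, hPt⟩
  · exact Or.inl hP
  · obtain ⟨b, hb⟩ := hPt
    exact Or.inr ⟨⟨t, ht⟩, b, hb⟩

/-- **Automorphism family from an index identity.**  If the certificate's check words are a typed code's flat `H^X` up
to a row bijection, every flat translation is a row-map automorphism of `rowMatrix n HX` (row map
`eX⁻¹ ∘ checkTranslateFlat t ∘ eX`).  (`H^Z`: the same lemma with `C.HZFlat`, see `BB.rowMatrix_aut_of_eq_submatrix_HZ`.) -/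
theorem BB.rowMatrix_aut_of_eq_submatrix (C : BB.Code ℓ m) {HX : List ℕ} (eX : Fin HX.length ≃ Fin (ℓ * m))
    (hX : rowMatrix (ℓ * m + ℓ * m) HX = C.HXFlat.submatrix eX id) (t : Mono ℓ m) :
    (rowMatrix (ℓ * m + ℓ * m) HX).submatrix (eX.symm ∘ BB.checkTranslateFlat t ∘ eX) (BB.translateFlat t) =
      rowMatrix (ℓ * m + ℓ * m) HX := by
  rw [hX]
  exact submatrix_aut_of_submatrix_equiv C.HXFlat eX (BB.HXFlat_submatrix_translateFlat C t)

/-- `H^Z` twin of `BB.rowMatrix_aut_of_eq_submatrix`. -/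
theorem BB.rowMatrix_aut_of_eq_submatrix_HZ (C : BB.Code ℓ m) {HZ : List ℕ} (eZ : Fin HZ.length ≃ Fin (ℓ * m))
    (hZ : rowMatrix (ℓ * m + ℓ * m) HZ = C.HZFlat.submatrix eZ id) (t : Mono ℓ m) :
    (rowMatrix (ℓ * m + ℓ * m) HZ).submatrix (eZ.symm ∘ BB.checkTranslateFlat t ∘ eZ) (BB.translateFlat t) =
      rowMatrix (ℓ * m + ℓ * m) HZ := by
  rw [hZ]
  exact submatrix_aut_of_submatrix_equiv C.HZFlat eZ (BB.HZFlat_submatrix_translateFlat C t)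

/-- Commutation of the certificate's check words from a typed code's, through the index identities. -/
theorem BB.rowMatrix_comm_of_eq_submatrix (C : BB.Code ℓ m) {HX HZ : List ℕ}
    (eX : Fin HX.length ≃ Fin (ℓ * m)) (eZ : Fin HZ.length ≃ Fin (ℓ * m))
    (hX : rowMatrix (ℓ * m + ℓ * m) HX = C.HXFlat.submatrix eX id)
    (hZ : rowMatrix (ℓ * m + ℓ * m) HZ = C.HZFlat.submatrix eZ id) :
    rowMatrix (ℓ * m + ℓ * m) HX * (rowMatrix (ℓ * m + ℓ * m) HZ)ᵀ = 0 := by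
  rw [hX, hZ, transpose_submatrix, ← Matrix.submatrix_mul _ _ _ _ _ Function.bijective_id,
    C.HXFlat_mul_HZFlat_transpose]
  simp

/-- Sanity re-derivation: the BZ-engine theorem `bzAut_translate_lower` IS `bzAut_lower_sound` applied to the two
engine-agnostic hypotheses. -/
example {HX HZ : List ℕ} {rcY rcS : RankCert} {L Ld : List ℕ} {s : BZSide} {wmax : ℕ} {found : List (ℕ × List ℕ)}
    (hcomm : rowMatrix (ℓ * m + ℓ * m) HX * (rowMatrix (ℓ * m + ℓ * m) HZ)ᵀ = 0)
    (hfound : foundOK HZ found = true)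
    (hcore : bzCoreOK (ℓ * m + ℓ * m) HX HZ rcY rcS L Ld s.evenWitness = true)
    (hlen : bzLenOK HZ rcS L s = true)
    (hb : ∀ b : ℕ, b < s.blocks.length → bzBlockOK (ℓ * m + ℓ * m) HZ rcS L wmax (found.map Prod.fst) s b = true)
    (ρX : Mono ℓ m → Fin HX.length → Fin HX.length) (ρZ : Mono ℓ m → Fin HZ.length → Fin HZ.length)
    (hXaut : ∀ t : Mono ℓ m,
      (rowMatrix (ℓ * m + ℓ * m) HX).submatrix (ρX t) (BB.translateFlat t) = rowMatrix (ℓ * m + ℓ * m) HX)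
    (hZaut : ∀ t : Mono ℓ m,
      (rowMatrix (ℓ * m + ℓ * m) HZ).submatrix (ρZ t) (BB.translateFlat t) = rowMatrix (ℓ * m + ℓ * m) HZ)
    {taus : List (ℕ × ℕ)} (hcov : coverAutTabOK ℓ m Ld L taus s.blocks = true)
    (w : Fin (ℓ * m + ℓ * m) → ZMod 2) (hw : rowMatrix (ℓ * m + ℓ * m) HX *ᵥ w = 0)
    (hw' : w ∉ rowSpace (rowMatrix (ℓ * m + ℓ * m) HZ)) : wmax < hammingNorm w :=
  bzAut_lower_sound (s := s) hcomm hfound hcore hlen hb _ _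
    (bzAut_translate_hφ hcomm hcore ρX ρZ hXaut hZaut taus) (bzAut_translate_hcover hcov) w hw hw'

end EngineAgnostic

end Summit.Ventures.QEC.Census
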